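import Summits.ResolutionOfSingularities.ResolutionOfSingularities.Theorems.PurelyInseparableDim4ChartTransposition
import HarnessLib

/-!
# Purely inseparable four-folds `z^p + F(x₁, …, x₄)`: a rational point of `𝔸⁵` OFF the centre `V(z, x_S)` with `x_j ≠ 0` has
# exactly ONE point above it in the blow-up, and it lies in the `x_j`-chart with explicit coordinates (brick S3 (c) «joint
# point∘coordinate chains», part 34 = v3-lite plumbing, cell `res-dim4-pi`)

[OURS · counted 0] (D-0157 DOOR 2; desk WORD #66 (4)(c), #74 (g), #99 (d); frame `PIDim4.TerminationImpliesOrderReduction`, S3 (c)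
v3-lite, memo `S3c-V3-DESIGN.md` Addendum 4; host item stmt-ResolutionOfSingularities-16155, helper). Nothing here proves resolution
of singularities in dimension ≥ 4 / characteristic `p` — NOT here, not anywhere in this programme.

For ANY blowing up `B : Bl → 𝔸⁵_K` of `V(z, x_S)` (universal property) and `j ∈ S`:
* `asIdeal_B_chartImm_pt` — the image under `B` of the rational point `c` of the `x_k`-chart is the rational point
  `(c_k c_m)_{m ∈ Λ∖k}, (c_m)_{otherwise}` (the chart substitution on points);
* `eq_of_apply_eq_of_isIso_morphismRestrict` — over an open `V` where `π|_V` is an isomorphism, `π` is injective on points;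
* **`eq_chartImm_of_B_eq_pt`** — if `B w` is the rational point `(a, b)` with `b_j ≠ 0` then
  `w = chartImm_j (a/b_j, (b_i/b_j)_{i ∈ S∖j}, b_j, (b_i)_{i ∉ S})`.
This is the plumbing by which a v3-lite WAITING member's points OFF the blown-up member are located inside the `x_j`-chart
(they have `x_j ≠ 0`), cf. the memo's cover argument.

AI-produced formalisation, weaker than expert review. bears_on: LADDER-RESOLUTION:D157-DOOR2 (res-dim4-pi · S3 (c) v3-lite · plumbing).
-/

set_option linter.dupNamespace false -- D-0017: single-problem summit path `Summit.<S>.<S>.…` by design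

noncomputable section

open MvPolynomial Finset CategoryTheory AlgebraicGeometry Opposite TopologicalSpace
open AlgebraicGeometry.Scheme.IdealSheafData (ofIdealTop vanishingIdeal)

namespace Summit.ResolutionOfSingularities.ResolutionOfSingularities.Theorems.PIDim4

open Literature.AlgebraicGeometry.Resolution
open Literature.AlgebraicGeometry.Resolution.AffinePointBlowup (P A γ coord Wtop ξ)

namespace ChartDictionary

/-! ## §1 Injectivity of a blowing up off its centre, on points -/

section Inj

universe u

/-- **Over an open `V` where `π|_V` is an isomorphism, `π` is injective on points.** [cite: GortzWedhorn2020, Prop. 13.91 (3)] -/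
theorem eq_of_apply_eq_of_isIso_morphismRestrict {W X : Scheme.{u}} {π : W ⟶ X} (V : X.Opens) [IsIso (π ∣_ V)]
    {w w' : W} (hw : π w ∈ V) (hw' : π w' ∈ V) (h : π w = π w') : w = w' := by
  obtain ⟨z, rfl⟩ := (Scheme.Opens.range_ι (π ⁻¹ᵁ V)).symm.subset hw
  obtain ⟨z', rfl⟩ := (Scheme.Opens.range_ι (π ⁻¹ᵁ V)).symm.subset hw'
  have h1 : V.ι ((π ∣_ V) z) = V.ι ((π ∣_ V) z') := by
    rw [← Scheme.Hom.comp_apply, ← Scheme.Hom.comp_apply, morphismRestrict_ι, Scheme.Hom.comp_apply,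
      Scheme.Hom.comp_apply, h]
  have h2 : (π ∣_ V) z = (π ∣_ V) z' := V.ι.isOpenEmbedding.injective h1
  have key : ∀ y, inv (π ∣_ V) ((π ∣_ V) y) = y := fun y => by
    rw [← Scheme.Hom.comp_apply, IsIso.hom_inv_id]
    rfl
  rw [← key z, h2, key z']

end Inj

/-! ## §2 The chart substitution on rational points -/

section RootPoint

variable {K : Type} [Field K] {S : Finset (Fin 4)} {j : Fin 4} {Bl : Scheme.{0}} {B : Bl ⟶ P 4 K}

open Classical in
/-- **The chart substitution on rational points**: `B(chartImm_k(c)) = (c_k·c_m for m ∈ Λ∖k, c_m otherwise)`.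
[cite: Hu2025, §5 Prop. 5.3 (the chart substitutions)] -/
theorem asIdeal_B_chartImm_pt {Λ : Set (Fin (4 + 1))} (hB : IsBlowup B (AffineCoordBlowup.𝓘Λ 4 K Λ)) {k : Fin (4 + 1)}
    (hk : k ∈ Λ) (c : Fin (4 + 1) → K) {x : P 4 K} (hx : x.asIdeal = MvPolynomial.vanishingIdeal K {c}) :
    (B (AffineCoordBlowup.chartImm hB hk x)).asIdeal =
      MvPolynomial.vanishingIdeal K {(fun m => if m ∈ Λ ∧ m ≠ k then c k * c m else c m : Fin (4 + 1) → K)} := by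
  rw [show B (AffineCoordBlowup.chartImm hB hk x) = (AffineCoordBlowup.chartImm hB hk ≫ B) x from rfl,
    AffineCoordBlowup.chartImm_comp]
  refine (specMap_aeval_apply_pt _ c x hx).trans ?_
  congr 2
  funext m
  split_ifs with h
  · rw [map_mul, aeval_X, aeval_X]
  · rw [aeval_X]

/-- The image point is NOT on the centre as soon as `c_k ≠ 0`. [folklore] -/
theorem B_chartImm_not_mem_CΛ {Λ : Set (Fin (4 + 1))} (hB : IsBlowup B (AffineCoordBlowup.𝓘Λ 4 K Λ)) {k : Fin (4 + 1)}
    (hk : k ∈ Λ) (c : Fin (4 + 1) → K) (hck : c k ≠ 0) {x : P 4 K} (hx : x.asIdeal = MvPolynomial.vanishingIdeal K {c}) :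
    B (AffineCoordBlowup.chartImm hB hk x) ∉ (AffineCoordBlowup.CΛ 4 K Λ : Set (P 4 K)) := by
  classical
  intro hmem
  rw [SetLike.mem_coe, AffineCoordBlowup.mem_CΛ_iff'] at hmem
  have h := hmem k hk
  rw [asIdeal_B_chartImm_pt hB hk c hx, MvPolynomial.mem_vanishingIdeal_singleton_iff, aeval_X] at h
  simp only [ne_eq, not_true_eq_false, and_false, if_false] at h
  exact hck h

/-- **THE POINT ABOVE A RATIONAL POINT WITH `x_j ≠ 0`** (`j ∈ S`): if `B w = (a, b)` with `b_j ≠ 0` then `w` is the point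
`(a/b_j, (b_i/b_j)_{i ∈ S∖j}, b_j, (b_i)_{i ∉ S})` of the `x_j`-chart — `B` is injective off the centre and that chart point maps to
`(a, b)`. [cite: GortzWedhorn2020, Prop. 13.91 (3)] [cite: Hu2025, §5 Prop. 5.3] -/
theorem eq_chartImm_of_B_eq_pt (hB : IsBlowup B (AffineCoordBlowup.𝓘Λ 4 K (insert 0 (Fin.succ '' (S : Set (Fin 4))))))
    (hj : j ∈ S) (a : K) (b : Fin 4 → K) (hb : b j ≠ 0) {w : Bl}
    (hw : (B w).asIdeal = MvPolynomial.vanishingIdeal K {(Fin.cons a b : Fin (4 + 1) → K)}) {x : P 4 K}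
    (hx : x.asIdeal = MvPolynomial.vanishingIdeal K {(Fin.cons (a * (b j)⁻¹)
      (fun i => if i ∈ S ∧ i ≠ j then b i * (b j)⁻¹ else b i) : Fin (4 + 1) → K)}) :
    w = AffineCoordBlowup.chartImm hB (succ_mem_centreVars hj) x := by
  classical
  set Λ : Set (Fin (4 + 1)) := insert 0 (Fin.succ '' (S : Set (Fin 4))) with hΛ
  set c : Fin (4 + 1) → K := Fin.cons (a * (b j)⁻¹) (fun i => if i ∈ S ∧ i ≠ j then b i * (b j)⁻¹ else b i) with hc
  have hcj : c j.succ = b j := by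
    rw [hc, Fin.cons_succ]
    simp
  -- the chart point maps to `(a, b)`
  have himg : (B (AffineCoordBlowup.chartImm hB (succ_mem_centreVars hj) x)).asIdeal =
      MvPolynomial.vanishingIdeal K {(Fin.cons a b : Fin (4 + 1) → K)} := by
    rw [asIdeal_B_chartImm_pt hB (succ_mem_centreVars hj) c hx]
    congr 2
    funext m
    refine Fin.cases ?_ (fun i => ?_) m
    · -- `z = z' · x_j`
      have h0 : (0 : Fin (4 + 1)) ∈ Λ ∧ (0 : Fin (4 + 1)) ≠ j.succ := ⟨Set.mem_insert _ _, (Fin.succ_ne_zero j).symm⟩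
      rw [if_pos h0, hcj, hc, Fin.cons_zero, Fin.cons_zero, mul_comm, inv_mul_cancel_right₀ hb]
    · rw [Fin.cons_succ]
      by_cases hiS : i ∈ S
      · by_cases hij : i = j
        · subst hij
          rw [if_neg (fun h => h.2 rfl), hcj]
        · have hm : i.succ ∈ Λ ∧ i.succ ≠ j.succ := ⟨succ_mem_centreVars hiS, fun h => hij (Fin.succ_injective _ h)⟩
          rw [if_pos hm, hcj, hc, Fin.cons_succ, if_pos ⟨hiS, hij⟩, mul_comm, inv_mul_cancel_right₀ hb]
      · rw [if_neg (fun h => succ_not_mem_centreVars hiS h.1), hc, Fin.cons_succ, if_neg (fun h => hiS h.1)]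
  -- injectivity off the centre
  haveI : IsIso (B ∣_ (AffineCoordBlowup.CΛ 4 K Λ).compl) := hB.isIso_morphismRestrict_compl_of_vanishingIdeal
  have hne : B (AffineCoordBlowup.chartImm hB (succ_mem_centreVars hj) x) ∉ (AffineCoordBlowup.CΛ 4 K Λ : Set (P 4 K)) :=
    B_chartImm_not_mem_CΛ hB (succ_mem_centreVars hj) c (by rw [hcj]; exact hb) hx
  have heq : B w = B (AffineCoordBlowup.chartImm hB (succ_mem_centreVars hj) x) := PrimeSpectrum.ext (hw.trans himg.symm)
  refine eq_of_apply_eq_of_isIso_morphismRestrict (π := B) (AffineCoordBlowup.CΛ 4 K Λ).compl ?_ hne heq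
  change B w ∉ (AffineCoordBlowup.CΛ 4 K Λ : Set (P 4 K))
  rw [heq]
  exact hne

end RootPoint

end ChartDictionary

end Summit.ResolutionOfSingularities.ResolutionOfSingularities.Theorems.PIDim4

end
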